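import Summits.ABC.ABC.Theorems.AbcExplicitTwoThirds
import HarnessLib

/-!
# The UNIFORM Stewart–Yu 1991 exponent `2/3 + C/log log G` from the explicit `κ(ε)` (papers lane ABC-P1, writer seat; theorems only)

`Summits/ABC/ABC/Theorems/AbcStewartYu1991Uniform.lean`.  The Theorem of Stewart–Yu, Math. Ann. 291 (1991), p. 226, as printed, is
the UNIFORM statement «there exists an effectively computable positive constant `c` such that for all positive integers `x, y, z` with
`(x, y, z) = 1`, `z > 2`, `x + y = z`: `log z < G^{2/3 + c/log log G}`» (`G = rad(xyz)`); the tree's leaf `stewartYu1991_upperBound` is only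
its «in particular» ε-clause.  With the ε-clause now EXPLICIT in ε (`abc_log_le_explicit_mul_rad_pow_twoThirds_add`, p486896: `κ(ε)` a closed
term, double-exponential in `1/ε`), the uniform shape follows by choosing `ε` as a function of `G`:

* `log_twoThirdsKappa_le` — for `0 < δ ≤ 1/2`: `log κ ≤ 100 · D^{1/δ}` for the closed term `κ` of the explicit theorem (any `D ≥ 169` with
  `1 ≤ log D ≤ 122`);
* `stewartYu1991_uniform_exponent` — **`∃ C > 0, ∀ abc triples with c ≥ 3: log c < rad(abc)^{2/3 + C/log log rad(abc)}`** — the printed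
  uniform shape (effectivity, as everywhere in the tree, is not part of the typed statement; the witness `C` is an explicit real of the proof).
  Proof: with `LL = log log G` (`G = rad ≥ 4`), if `LL ≥ 4 log D` take `ε = (16/3)·log D / LL ≤ 4/3`, so that `δ = 3ε/8 = 2 log D/LL` and
  `D^{1/δ} = exp(LL/2) = √(log G)`, whence `log κ(ε) + ε log G ≤ 100 √(log G) + (16/3) log D · log G / LL < C log G / LL`; otherwise take `ε = 1`
  and absorb `κ(1) G` into `G^{C/LL − 1} ≥ 4^{C/(4 log D) − 1}`.

No new definition; [folklore] optimisation in `ε` on a landed theorem.  WHAT THIS IS NOT: not the printed EFFECTIVITY (the kernel `C` is a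
silly explicit real, `> 10^{142}`); no progress on abc; no arithmetical use claimed. [cite: StewartYu1991, Theorem (p. 226)]
-/

set_option linter.dupNamespace false

noncomputable section

open Finset Real
open Literature.NumberTheory.DiophantineGeometry
open Literature.NumberTheory.DiophantineGeometry.Pasten
open Literature.Barriers.ABC

namespace Summit.ABC.ABC.Theorems

/-- **Size of the explicit constant.** For `0 < δ ≤ 1/2` and any real `D ≥ 169` with `1 ≤ log D ≤ 122`, the closed term
`κ = (6·(23040000·D^{⌈D^{1/δ}⌉}·(12/δ)^{12})^{1/3}/δ)^{1/(1−δ)}` of `abc_log_le_explicit_mul_rad_pow_twoThirds_add` satisfies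
`log κ ≤ 100 · D^{1/δ}`. [folklore] -/
theorem log_twoThirdsKappa_le {D δ : ℝ} (hD : 169 ≤ D) (hlD1 : 1 ≤ Real.log D) (hlD2 : Real.log D ≤ 122)
    (hδ : 0 < δ) (hδ2 : δ ≤ 1 / 2) :
    Real.log ((6 * (23040000 * D ^ ⌈D ^ (1 / δ)⌉₊ * (12 / δ) ^ 12) ^ (1 / 3 : ℝ) / δ) ^ (1 / (1 - δ))) ≤
      100 * D ^ (1 / δ) := by
  have hD0 : 0 < D := by linarith
  have hD1 : 1 ≤ D := by linarith
  set M : ℝ := D ^ (1 / δ) with hM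
  have hM0 : 0 < M := Real.rpow_pos_of_pos hD0 _
  -- `M ≥ D ≥ 169` (exponent `1/δ ≥ 2 ≥ 1`)
  have h1δ : 2 ≤ 1 / δ := by rw [le_div_iff₀ hδ]; linarith
  have hMD : D ≤ M := by
    calc D = D ^ (1 : ℝ) := (Real.rpow_one D).symm
      _ ≤ D ^ (1 / δ) := Real.rpow_le_rpow_of_exponent_le hD1 (by linarith)
  have hM169 : 169 ≤ M := hD.trans hMD
  -- `1/δ ≤ (1/δ)·log D ≤ M` (`y ≤ exp y`)
  have hδM : 1 / δ ≤ M := by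
    have h1 : 1 / δ ≤ (1 / δ) * Real.log D := le_mul_of_one_le_right (by positivity) hlD1
    have h2 : (1 / δ) * Real.log D ≤ Real.exp ((1 / δ) * Real.log D) := by
      linarith [Real.add_one_le_exp ((1 / δ) * Real.log D)]
    have h3 : Real.exp ((1 / δ) * Real.log D) = M := by
      rw [hM, Real.rpow_def_of_pos hD0, mul_comm]
    linarith
  -- `log(1/δ) ≤ 1/δ ≤ M`
  have hlogδ : Real.log (1 / δ) ≤ M := by
    have := Real.log_le_sub_one_of_pos (show (0 : ℝ) < 1 / δ by positivity)
    linarith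
  -- the pieces of the term
  set N : ℕ := ⌈M⌉₊ with hN
  have hNM : (N : ℝ) ≤ M + 1 := by
    rw [hN]; exact (Nat.ceil_lt_add_one hM0.le).le
  set K₀ : ℝ := 23040000 * D ^ N * (12 / δ) ^ 12 with hK₀
  have hDN : 0 < D ^ N := pow_pos hD0 N
  have h12δ : 0 < 12 / δ := by positivity
  have hK₀0 : 0 < K₀ := by rw [hK₀]; positivity
  have hlogK₀ : Real.log K₀ ≤ 136 * M := by
    have e1 : Real.log K₀ = Real.log 23040000 + (N : ℝ) * Real.log D + 12 * Real.log (12 / δ) := by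
      rw [hK₀, Real.log_mul (by positivity) (by positivity), Real.log_mul (by norm_num) hDN.ne',
        Real.log_pow, Real.log_pow]
      push_cast; ring
    have h23 : Real.log 23040000 ≤ 17 := by
      rw [Real.log_le_iff_le_exp (by norm_num)]
      have h := Real.exp_one_gt_d9
      have : (2.7182818283 : ℝ) ^ 17 ≤ Real.exp 1 ^ 17 := pow_le_pow_left₀ (by norm_num) h.le 17
      rw [← Real.exp_nat_mul] at this
      norm_num at this ⊢
      linarith
    have h12 : Real.log (12 / δ) ≤ 3 + M := by
      rw [Real.log_div (by norm_num) hδ.ne']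
      have hl12 : Real.log 12 ≤ 3 := by
        rw [Real.log_le_iff_le_exp (by norm_num)]
        have h := Real.exp_one_gt_d9
        have : (2.7182818283 : ℝ) ^ 3 ≤ Real.exp 1 ^ 3 := pow_le_pow_left₀ (by norm_num) h.le 3
        rw [← Real.exp_nat_mul] at this
        norm_num at this ⊢
        linarith
      have hlδ' : -Real.log δ ≤ M := by rw [← Real.log_inv]; rwa [inv_eq_one_div]
      linarith
    have hNlogD : (N : ℝ) * Real.log D ≤ 122 * M + 122 := by
      calc (N : ℝ) * Real.log D ≤ (M + 1) * 122 :=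
            mul_le_mul hNM hlD2 (by linarith) (by linarith)
        _ = 122 * M + 122 := by ring
    rw [e1]
    nlinarith
  set K : ℝ := K₀ ^ (1 / 3 : ℝ) with hK
  have hK0 : 0 < K := Real.rpow_pos_of_pos hK₀0 _
  have hlogK : Real.log K ≤ 46 * M := by
    rw [hK, Real.log_rpow hK₀0]
    linarith
  set X : ℝ := 6 * K / δ with hX
  have hX0 : 0 < X := by rw [hX]; positivity
  have hlogX : Real.log X ≤ 49 * M := by
    have e2 : Real.log X = Real.log 6 + Real.log K + Real.log (1 / δ) := by
      rw [hX, show 6 * K / δ = 6 * K * (1 / δ) by ring, Real.log_mul (by positivity) (by positivity),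
        Real.log_mul (by norm_num) hK0.ne']
    have hl6 : Real.log 6 ≤ 2 := by
      rw [Real.log_le_iff_le_exp (by norm_num)]
      have h := Real.exp_one_gt_d9
      have : (2.7182818283 : ℝ) ^ 2 ≤ Real.exp 1 ^ 2 := pow_le_pow_left₀ (by norm_num) h.le 2
      rw [← Real.exp_nat_mul] at this
      norm_num at this ⊢
      linarith
    rw [e2]
    linarith
  have hlogX0 : 0 ≤ Real.log X := by
    apply Real.log_nonneg
    rw [hX, le_div_iff₀ hδ]
    have hK1 : 1 ≤ K := by
      rw [hK]
      apply Real.one_le_rpow _ (by norm_num)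
      rw [hK₀]
      have h1 : (1 : ℝ) ≤ D ^ N := one_le_pow₀ hD1
      have h2 : (1 : ℝ) ≤ (12 / δ) ^ 12 := one_le_pow₀ (by rw [le_div_iff₀ hδ]; linarith)
      nlinarith
    nlinarith
  -- `log κ = (1/(1-δ)) · log X ≤ 2 · log X`
  have h1δ' : 1 / (1 - δ) ≤ 2 := by
    rw [div_le_iff₀ (by linarith)]; linarith
  rw [Real.log_rpow hX0]
  calc 1 / (1 - δ) * Real.log X ≤ 2 * Real.log X :=
        mul_le_mul_of_nonneg_right h1δ' hlogX0
    _ ≤ 2 * (49 * M) := by linarith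
    _ ≤ 100 * M := by linarith

/-- `rad(abc) ≥ 4` (indeed `≥ 6`) for an abc triple with `c ≥ 3`: `ab ≥ 2` and `c ≥ 3` carry two distinct primes. [folklore] -/
theorem four_le_rad_real {a b c : ℕ} (h : IsABCTriple a b c) (hc : 3 ≤ c) : (4 : ℝ) ≤ (rad a b c : ℝ) := by
  classical
  obtain ⟨ha, hb, habc, hcop⟩ := id h
  have hc0 : c ≠ 0 := by omega
  have hab2 : 2 ≤ a * b := by
    rcases Nat.lt_or_ge 1 a with ha1 | ha1
    · nlinarith
    · have ha' : a = 1 := by omega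
      subst ha'; omega
  obtain ⟨q, hq⟩ := Nat.nonempty_primeFactors.mpr (show 1 < a * b by omega)
  obtain ⟨r, hr⟩ := Nat.nonempty_primeFactors.mpr (show 1 < c by omega)
  have hqP := Nat.prime_of_mem_primeFactors hq
  have hrP := Nat.prime_of_mem_primeFactors hr
  have hcopc : (a * b).Coprime c :=
    Nat.Coprime.mul_left (coprime_left_of_isABCTriple h) (coprime_right_of_isABCTriple h)
  have hqr : q ≠ r := fun heq =>
    Finset.disjoint_left.mp hcopc.disjoint_primeFactors hq (heq ▸ hr)
  have hS : ({q, r} : Finset ℕ) ⊆ (a * b * c).primeFactors := by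
    intro x hx
    rw [Nat.primeFactors_mul (by positivity) hc0]
    rcases Finset.mem_insert.mp hx with rfl | hx
    · exact Finset.mem_union_left _ hq
    · rw [Finset.mem_singleton] at hx; subst hx; exact Finset.mem_union_right _ hr
  have hrad : rad a b c = ∏ p ∈ (a * b * c).primeFactors, p := by
    rw [rad_def, Nat.radical_eq_prod_primeFactors]
  have hle : q * r ≤ rad a b c := by
    have hpair : ∏ p ∈ ({q, r} : Finset ℕ), p = q * r := Finset.prod_pair hqr
    rw [hrad, ← hpair]
    exact Finset.prod_le_prod_of_subset_of_one_le' hS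
      (fun p hp _ => (Nat.prime_of_mem_primeFactors hp).one_lt.le)
  have h4 : 2 * 2 ≤ q * r := Nat.mul_le_mul hqP.two_le hrP.two_le
  exact_mod_cast (show 4 ≤ rad a b c by omega)

/-- **Stewart–Yu 1991, the UNIFORM exponent.** There is a real `C > 0` such that every abc triple `a + b = c` with `c ≥ 3`
satisfies `log c < G^{2/3 + C/log log G}`, `G = rad(abc)` — the shape of the Theorem of Math. Ann. 291 (1991), p. 226
(«`log z < G^{2/3 + c/log log G}` for `(x, y, z) = 1`, `z > 2`, `x + y = z`»), obtained from the tree's explicit ε-form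
`abc_log_le_explicit_mul_rad_pow_twoThirds_add` by choosing `ε = (16/3)·log D / log log G` for `log log G ≥ 4 log D` and `ε = 1` otherwise
(`D = (24600·2^73)^2`).  The printed EFFECTIVITY of `c` is not part of the typed statement (the proof's witness is an explicit but absurd real).
[cite: StewartYu1991, Theorem (p. 226)] -/
theorem stewartYu1991_uniform_exponent :
    ∃ C : ℝ, 0 < C ∧ ∀ a b c : ℕ, IsABCTriple a b c → 3 ≤ c →
      Real.log c < (rad a b c : ℝ) ^ (2 / 3 + C / Real.log (Real.log (rad a b c : ℝ))) := by
  classical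
  -- the constant `D` of the explicit theorem and its size
  set D : ℝ := (24600 * 2 ^ 73 : ℝ) ^ 2 with hD
  have hD169 : (169 : ℝ) ≤ D := by rw [hD]; norm_num
  have hD0 : 0 < D := by linarith
  have hlD1 : 1 ≤ Real.log D := by
    rw [← Real.log_exp 1]
    apply Real.log_le_log (Real.exp_pos 1)
    have := Real.exp_one_lt_d9; linarith
  have hlD2 : Real.log D ≤ 122 := by
    have h1 : D ≤ 2 ^ 176 := by rw [hD]; norm_num
    have h2 : Real.log D ≤ Real.log ((2 : ℝ) ^ 176) := Real.log_le_log hD0 h1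
    have h3 : Real.log ((2 : ℝ) ^ 176) = 176 * Real.log 2 := by
      rw [Real.log_pow]; norm_num
    have := Real.log_two_lt_d9
    linarith
  set LD : ℝ := Real.log D with hLD
  have hLD0 : 0 < LD := by linarith
  -- the explicit bound at `ε = 1`
  obtain ⟨κ₁, hκ₁0, hκ₁⟩ : ∃ κ₁ : ℝ, 0 < κ₁ ∧ ∀ a b c : ℕ, IsABCTriple a b c → 3 ≤ c →
      Real.log c ≤ κ₁ * (rad a b c : ℝ) ^ (2 / 3 + 1 : ℝ) :=
    ⟨_, by positivity, fun a b c ht hc => abc_log_le_explicit_mul_rad_pow_twoThirds_add one_pos a b c ht hc⟩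
  set κ₁' : ℝ := max κ₁ 1 with hκ₁'
  have hκ₁'1 : 1 ≤ κ₁' := le_max_right _ _
  have hlκ₁' : 0 ≤ Real.log κ₁' := Real.log_nonneg hκ₁'1
  have hlκ₁ : Real.log κ₁ ≤ Real.log κ₁' := Real.log_le_log hκ₁0 (le_max_left _ _)
  have hl4 : 1 < Real.log 4 := by
    rw [Real.lt_log_iff_exp_lt (by norm_num)]
    have := Real.exp_one_lt_d9; linarith
  have hl40 : 0 < Real.log 4 := by linarith
  set r₁ : ℝ := Real.log κ₁' / Real.log 4 with hr₁
  have hr₁0 : 0 ≤ r₁ := div_nonneg hlκ₁' hl40.le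
  -- the constant
  set C : ℝ := 201 + 16 / 3 * LD + 4 * LD * (2 + r₁) with hC
  have hC0 : 0 < C := by
    have : 0 ≤ 4 * LD * (2 + r₁) := by positivity
    linarith
  refine ⟨C, hC0, ?_⟩
  intro a b c ht hc3
  set G : ℝ := (rad a b c : ℝ) with hGdef
  have hG4 : 4 ≤ G := four_le_rad_real ht hc3
  have hG0 : 0 < G := by linarith
  set LG : ℝ := Real.log G with hLGdef
  have hLG4 : Real.log 4 ≤ LG := Real.log_le_log (by norm_num) hG4
  have hLG1 : 1 < LG := lt_of_lt_of_le hl4 hLG4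
  have hLG0 : 0 < LG := by linarith
  set LL : ℝ := Real.log LG with hLLdef
  have hLL0 : 0 < LL := Real.log_pos hLG1
  have hGpow : ∀ x : ℝ, G ^ x = Real.exp (x * LG) := fun x => by
    rw [Real.rpow_def_of_pos hG0, mul_comm]
  rw [hGpow]
  by_cases hcase : 4 * LD ≤ LL
  · -- many primes: `ε = (16/3) log D / log log G ≤ 4/3`
    set ε : ℝ := 16 / 3 * LD / LL with hε
    have hε0 : 0 < ε := by positivity
    have hεLL : ε * LL = 16 / 3 * LD := by rw [hε]; field_simp
    have hε43 : ε ≤ 4 / 3 := by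
      rw [hε, div_le_iff₀ hLL0]; linarith
    have hδ : min (1 / 2 : ℝ) (3 * ε / 8) = 3 * ε / 8 := min_eq_right (by linarith)
    have hA := abc_log_le_explicit_mul_rad_pow_twoThirds_add hε0 a b c ht hc3
    rw [hδ] at hA
    set κ : ℝ := (6 * (23040000 * D ^ ⌈D ^ (1 / (3 * ε / 8))⌉₊ * (12 / (3 * ε / 8)) ^ 12) ^ (1 / 3 : ℝ) /
      (3 * ε / 8)) ^ (1 / (1 - 3 * ε / 8)) with hκdef
    have hκ0 : 0 < κ := by rw [hκdef]; positivity
    have hlogκ : Real.log κ ≤ 100 * D ^ (1 / (3 * ε / 8)) :=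
      log_twoThirdsKappa_le hD169 hlD1 hlD2 (by positivity) (by linarith)
    -- `D^{1/δ} = exp(LL/2) = √(log G)`
    have hM : D ^ (1 / (3 * ε / 8)) = Real.exp (LL / 2) := by
      rw [Real.rpow_def_of_pos hD0, ← hLD]
      congr 1
      have hLL0' : LL ≠ 0 := hLL0.ne'
      rw [hε]
      field_simp
      ring
    have hS0 : 0 < Real.exp (LL / 2) := Real.exp_pos _
    have hS2 : Real.exp (LL / 2) * Real.exp (LL / 2) = LG := by
      rw [← Real.exp_add, show LL / 2 + LL / 2 = LL by ring, hLLdef, Real.exp_log hLG0]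
    have hLLS : LL ≤ 2 * Real.exp (LL / 2) := by
      have := Real.add_one_le_exp (LL / 2); linarith
    have key : Real.log κ + (2 / 3 + ε) * LG < (2 / 3 + C / LL) * LG := by
      have h1 : ε * LG = 16 / 3 * LD * LG / LL := by rw [hε]; ring
      have hCge : 201 + 16 / 3 * LD ≤ C := by
        have : 0 ≤ 4 * LD * (2 + r₁) := by positivity
        linarith
      have h2 : (201 + 16 / 3 * LD) * LG / LL ≤ C * LG / LL :=
        div_le_div_of_nonneg_right (mul_le_mul_of_nonneg_right hCge hLG0.le) hLL0.le
      have h2' : C * LG / LL = C / LL * LG := by ring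
      have h3 : 100 * Real.exp (LL / 2) < 201 * LG / LL := by
        rw [lt_div_iff₀ hLL0]
        have h3a : Real.exp (LL / 2) * LL ≤ Real.exp (LL / 2) * (2 * Real.exp (LL / 2)) :=
          mul_le_mul_of_nonneg_left hLLS hS0.le
        have h3b : Real.exp (LL / 2) * (2 * Real.exp (LL / 2)) = 2 * LG := by rw [← hS2]; ring
        nlinarith [h3a, h3b, hLG0]
      calc Real.log κ + (2 / 3 + ε) * LG ≤ 100 * Real.exp (LL / 2) + (2 / 3 + ε) * LG := by
            rw [← hM]; linarith
        _ < 201 * LG / LL + (2 / 3 + ε) * LG := by linarith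
        _ = 2 / 3 * LG + (201 + 16 / 3 * LD) * LG / LL := by rw [add_mul, h1]; ring
        _ ≤ 2 / 3 * LG + C / LL * LG := by rw [← h2']; linarith
        _ = (2 / 3 + C / LL) * LG := by ring
    calc Real.log c ≤ κ * G ^ (2 / 3 + ε) := hA
      _ = Real.exp (Real.log κ + (2 / 3 + ε) * LG) := by
          rw [Real.exp_add, Real.exp_log hκ0, hGpow]
      _ < Real.exp ((2 / 3 + C / LL) * LG) := Real.exp_lt_exp.mpr key
  · -- few primes: `ε = 1`, the constant is absorbed by `G^{C/log log G − 1}`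
    push Not at hcase
    have hB := hκ₁ a b c ht hc3
    have key : Real.log κ₁ + (2 / 3 + 1) * LG < (2 / 3 + C / LL) * LG := by
      -- `C/LL > C/(4 LD) ≥ 2 + r₁`
      have h1 : C / (4 * LD) < C / LL := div_lt_div_of_pos_left hC0 hLL0 hcase
      have h2 : 2 + r₁ ≤ C / (4 * LD) := by
        rw [le_div_iff₀ (by positivity)]
        have : (0 : ℝ) ≤ 201 + 16 / 3 * LD := by positivity
        rw [hC]; linarith
      have h3 : (2 + r₁) * LG < C / LL * LG := by
        apply mul_lt_mul_of_pos_right _ hLG0; linarith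
      -- `r₁ · LG ≥ log κ₁' ≥ log κ₁`
      have h4 : Real.log κ₁' ≤ r₁ * LG := by
        calc Real.log κ₁' = r₁ * Real.log 4 := by rw [hr₁]; field_simp
          _ ≤ r₁ * LG := mul_le_mul_of_nonneg_left hLG4 hr₁0
      linarith [h1, h2, h3, h4, hlκ₁, hLG0]
    calc Real.log c ≤ κ₁ * G ^ (2 / 3 + 1 : ℝ) := hB
      _ = Real.exp (Real.log κ₁ + (2 / 3 + 1) * LG) := by
          rw [Real.exp_add, Real.exp_log hκ₁0, hGpow]
      _ < Real.exp ((2 / 3 + C / LL) * LG) := Real.exp_lt_exp.mpr key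

end Summit.ABC.ABC.Theorems

end
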